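import Mathlib
import Summits.Ventures.HodgeRepro.Tier4.Target
import Summits.Ventures.HodgeRepro.Tier4.Line3.Defs
import Summits.Ventures.HodgeRepro.Tier4.Line3.DefsLemmas
import Summits.Ventures.HodgeRepro.Tier4.Line3.ClassBoundGauss
import Summits.Ventures.HodgeRepro.Tier4.Line3.GaussRatioFormula
import Summits.Ventures.HodgeRepro.Tier4.Line3.CopyWeightGaussian
import Summits.Ventures.HodgeRepro.Tier4.Line3.IntegralScalarExcess
import Summits.Ventures.HodgeRepro.Tier4.Line3.ShrinkMajGauss
import Summits.Ventures.HodgeRepro.Tier4.Line3.CopyCountRay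

/-!
# Tier4/Line3/QuarticProfile — the signed profile condition holds in the QUARTIC case on every ratio-balanced centre

Blind re-derivation cell `pub-hodge-repro`, Tier 4 «PROVE THE STEP», LINE L3, seat t4-x2 (g3, reserve wall-breaker);
the `m = 2` case of proofs/t4/L3/ARCH-COPY-PROFILE-x2.md §3 as kernel statements.  For a quartic CM field the definite
embeddings are one conjugate pair `{σ₁, σ̄₁}` (`QuarticShape`, displayed: the shape of `defEmb`), so the signed profile exponent
of a slot is `E(t, u) = (t² − 1) h + 2 (u² − 1) q` with `t = ‖τ₀ ε‖`, `u = ‖σ₁ ε‖`, `h = tauSize (xm j)`, `q = defQuad σ₁ (xm j)`,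
and the product formula reads `t² u² = |N(ε)| ≥ 1`.  Two root-free real lemmas:
* `slot_pos_of_two_le_norm`: for `|N| ≥ 2`, `E > 0` whenever the sizes satisfy `h² − 12 h q + 4 q² < 0` (the discriminant of
  `h s² − (h + 2q) s + 4q`), i.e. `h/q ∈ (6 − 4√2, 6 + 4√2) = (0.343, 11.66)`;
* `slot_pos_of_unit`: for `|N| = 1`, `E = (s − 1)(s h − 2q)/s` with `s = t²`, positive when `s ∉ [min(1, r), max(1, r)]`,
  `r = 2q/h` — which the UNIT GAP supplies: `s = τ₀(c(ε) ε)` is a totally positive unit of `E⁺`, so `s ≥ η₀` or `s ≤ 1/η₀`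
  for the fundamental totally positive unit `η₀ > 1` (`UnitGap`, displayed), and `1/η₀ < r < η₀` does it.
Hence (`profileExc_pos_quartic`): on a quartic field, for a centre whose slot ratios `r_j = 2 q_j / h_j` lie in
`(1/η₀, η₀)` and whose sizes satisfy the discriminant condition, `profileExc ε xm > 0` for every non-norm-one tuple of
non-zero algebraic integers — the STRICT SIGNED PROFILE CONDITION of CopyCountRayRed, for every such centre.  For `D = 5`,
`η₀ = φ² = 2.618…`, so any ratio in `(0.382, 2.618)` with `h/q ∈ (0.343, 11.66)` works.

Nothing here says anything about the status of the Hodge conjecture for CM abelian varieties, which is NOT proved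
(HC_CM is NOT proved by anyone in this repository).
-/

set_option autoImplicit false

noncomputable section

namespace Summit.Ventures.HodgeRepro.Tier4.Line3

open Summit.Ventures.HodgeRepro.Tier4
open Matrix NumberField
open scoped ComplexConjugate
open scoped Classical

/-! ## A. The two real lemmas -/

/-- Non-units: for `s > 0`, `N ≥ 2`, `h > 0`, `q > 0` with `h² − 12 h q + 4 q² < 0`:
`(s − 1) h + 2 (N / s − 1) q > 0`. -/
theorem slot_pos_of_two_le_norm {s N h q : ℝ} (hs : 0 < s) (hN : 2 ≤ N) (hh : 0 < h) (hq : 0 < q)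
    (hdisc : h ^ 2 - 12 * h * q + 4 * q ^ 2 < 0) : 0 < (s - 1) * h + 2 * (N / s - 1) * q := by
  have h1 : (s - 1) * h + 2 * (N / s - 1) * q = (h * s ^ 2 - (h + 2 * q) * s + 2 * N * q) / s := by
    field_simp
    ring
  rw [h1]
  apply div_pos _ hs
  have h2 : 4 * q ≤ 2 * N * q := by nlinarith
  have h3 : 0 < 4 * h * (h * s ^ 2 - (h + 2 * q) * s + 4 * q) := by
    nlinarith [sq_nonneg (2 * h * s - (h + 2 * q))]
  have h4 : 0 < h * s ^ 2 - (h + 2 * q) * s + 4 * q := by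
    by_contra hcon
    have hcon' := not_lt.mp hcon
    nlinarith
  linarith

/-- Units: for `s > 0`, `h > 0`, `q > 0`, `r := 2q/h`, and `s ≥ η₀` or `s ≤ 1/η₀` with `1/η₀ < r < η₀`:
`(s − 1) h + 2 (1 / s − 1) q > 0`. -/
theorem slot_pos_of_unit {s h q η₀ : ℝ} (hs : 0 < s) (hh : 0 < h) (hη : 1 < η₀)
    (hgap : η₀ ≤ s ∨ s ≤ 1 / η₀) (hr1 : 1 / η₀ < 2 * q / h) (hr2 : 2 * q / h < η₀) :
    0 < (s - 1) * h + 2 * (1 / s - 1) * q := by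
  have h1 : (s - 1) * h + 2 * (1 / s - 1) * q = (s - 1) * (s * h - 2 * q) / s := by
    field_simp
    ring
  rw [h1]
  apply div_pos _ hs
  have hη0 : 0 < η₀ := by linarith
  rcases hgap with hge | hle
  · -- `s ≥ η₀ > 1` and `s > r`: both factors positive
    have hs1 : 0 < s - 1 := by linarith
    have hsh : 0 < s * h - 2 * q := by
      have h2 : 2 * q < η₀ * h := by
        rw [div_lt_iff₀ hh] at hr2
        linarith
      nlinarith
    exact mul_pos hs1 hsh
  · -- `s ≤ 1/η₀ < 1` and `s < r`: both factors negative
    have hs1 : s - 1 < 0 := by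
      have : 1 / η₀ < 1 := by rw [div_lt_one hη0]; exact hη
      linarith
    have hsh : s * h - 2 * q < 0 := by
      rw [lt_div_iff₀ hh] at hr1
      have h3 : s * h ≤ (1 / η₀) * h := mul_le_mul_of_nonneg_right hle hh.le
      linarith
    exact mul_pos_of_neg_of_neg hs1 hsh

/-- Norm-one slots contribute nothing: `t = u = 1` gives `E = 0`. -/
theorem slot_zero_of_norm_one {h q : ℝ} : ((1 : ℝ) ^ 2 - 1) * h + 2 * ((1 : ℝ) ^ 2 - 1) * q = 0 := by ring

/-! ## B. The quartic shape -/

namespace T4Data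

variable (X : T4Data)

/-- **THE QUARTIC SHAPE** (displayed): the definite embeddings are one conjugate pair. -/
def QuarticShape : Prop := ∃ σ₁ : X.E →+* ℂ, σ₁ ≠ conjEmb σ₁ ∧ X.defEmb = {σ₁, conjEmb σ₁}

/-- **THE UNIT GAP** (displayed arithmetic input, `η₀ > 1` the fundamental totally positive unit of `E⁺`): a non-zero
algebraic integer of absolute norm `1` that is not norm-one has `τ₀`-size `‖τ₀ x‖² ≥ η₀` or `≤ 1/η₀`. -/
def UnitGap (η₀ : ℝ) : Prop :=
  ∀ x : X.E, IsIntegral ℤ x → x ≠ 0 → |Algebra.norm ℚ x| = 1 → X.c x * x ≠ 1 →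
    η₀ ≤ ‖X.τ₀ x‖ ^ 2 ∨ ‖X.τ₀ x‖ ^ 2 ≤ 1 / η₀

/-- The conjugate embedding has the same norms. -/
theorem norm_conjEmb_apply (σ : X.E →+* ℂ) (x : X.E) : ‖conjEmb σ x‖ = ‖σ x‖ := by
  show ‖conj (σ x)‖ = ‖σ x‖
  exact Complex.norm_conj _

/-- The definite size at the conjugate embedding is the same. -/
theorem defQuad_conjEmb (σ : X.E →+* ℂ) (x : Fin 3 → X.E) : X.defQuad (conjEmb σ) x = X.defQuad σ x := by
  unfold defQuad
  have h : (star (fun i => conjEmb σ (x i)) ⬝ᵥ ((X.H.map (conjEmb σ)) *ᵥ (fun i => conjEmb σ (x i)))) =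
      conj (star (fun i => σ (x i)) ⬝ᵥ ((X.H.map σ) *ᵥ (fun i => σ (x i)))) := by
    simp only [conjEmb, RingHom.comp_apply, dotProduct, Matrix.mulVec, Matrix.map_apply, Pi.star_apply,
      Complex.star_def, map_sum, map_mul, Complex.conj_conj]
  rw [h, Complex.conj_re]

/-- In the quartic shape the absolute norm is `‖τ₀ x‖² · ‖σ₁ x‖²`. -/
theorem abs_norm_eq_quartic {σ₁ : X.E →+* ℂ} (hσ : σ₁ ≠ conjEmb σ₁) (hdef : X.defEmb = {σ₁, conjEmb σ₁}) (x : X.E) :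
    ((|Algebra.norm ℚ x| : ℚ) : ℝ) = ‖X.τ₀ x‖ ^ 2 * ‖σ₁ x‖ ^ 2 := by
  rw [abs_norm_eq_prod_norm_emb, ← Finset.prod_filter_mul_prod_filter_not Finset.univ
    (fun σ : X.E →+* ℂ => σ ≠ X.τ₀ ∧ σ ≠ conjEmb X.τ₀), X.filter_not_def_eq, Finset.prod_pair X.tau_ne_conjEmb,
    X.norm_conjEmb_tau]
  have h1 : (Finset.univ.filter (fun σ : X.E →+* ℂ => σ ≠ X.τ₀ ∧ σ ≠ conjEmb X.τ₀)) = {σ₁, conjEmb σ₁} := hdef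
  rw [h1, Finset.prod_pair hσ, X.norm_conjEmb_apply]
  ring

/-- The absolute norm of a non-zero algebraic integer is `1` or `≥ 2`. -/
theorem abs_norm_eq_one_or_two_le {x : X.E} (hx : IsIntegral ℤ x) (h0 : x ≠ 0) :
    |Algebra.norm ℚ x| = 1 ∨ 2 ≤ |Algebra.norm ℚ x| := by
  set y : 𝓞 X.E := ⟨x, hx⟩ with hy
  have hy0 : y ≠ 0 := by
    intro h
    apply h0
    have := congrArg (fun z : 𝓞 X.E => (z : X.E)) h
    simpa [hy] using this
  have hne : Algebra.norm ℤ y ≠ 0 := (Algebra.norm_ne_zero_iff (R := ℤ)).mpr hy0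
  have h2 : ((Algebra.norm ℤ y : ℤ) : ℚ) = Algebra.norm ℚ x := Algebra.coe_norm_int y
  have h3 : ((|Algebra.norm ℤ y| : ℤ) : ℚ) = |Algebra.norm ℚ x| := by rw [Int.cast_abs, h2]
  have h4 : |Algebra.norm ℤ y| = 1 ∨ 2 ≤ |Algebra.norm ℤ y| := by
    have := Int.one_le_abs hne
    omega
  rcases h4 with h4 | h4
  · left
    rw [← h3, h4]
    norm_num
  · right
    rw [← h3]
    exact_mod_cast h4


/-- The slot exponent in the quartic shape: the definite sum is `2 (‖σ₁ ε‖² − 1) defQuad σ₁ v`. -/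
theorem slot_exc_eq {σ₁ : X.E →+* ℂ} (hσ : σ₁ ≠ conjEmb σ₁) (hdef : X.defEmb = {σ₁, conjEmb σ₁}) (ε : X.E)
    (v : Fin 3 → X.E) :
    (‖X.τ₀ ε‖ ^ 2 - 1) * X.tauSize v + ∑ σ ∈ X.defEmb, (‖σ ε‖ ^ 2 - 1) * X.defQuad σ v =
      (‖X.τ₀ ε‖ ^ 2 - 1) * X.tauSize v + 2 * (‖σ₁ ε‖ ^ 2 - 1) * X.defQuad σ₁ v := by
  rw [hdef, Finset.sum_pair hσ, X.norm_conjEmb_apply, X.defQuad_conjEmb]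
  ring

/-- The conjugation of the CM field is intertwined with complex conjugation by every embedding. -/
theorem conj_emb_c (σ : X.E →+* ℂ) (y : X.E) : σ (X.c y) = conj (σ y) :=
  IsCMField.complexEmbedding_complexConj X.E σ y

/-- **THE SLOT EXPONENT IS NON-NEGATIVE, AND POSITIVE OFF THE NORM-ONE SCALARS**, in the quartic shape, under the unit gap
and the ratio / discriminant conditions of the slot. -/
theorem slot_exc_nonneg_pos {σ₁ : X.E →+* ℂ} (hσ : σ₁ ≠ conjEmb σ₁) (hdef : X.defEmb = {σ₁, conjEmb σ₁}) {η₀ : ℝ}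
    (hη : 1 < η₀) (hU : X.UnitGap η₀) {v : Fin 3 → X.E} (hv : v ≠ 0)
    (hr1 : 1 / η₀ < 2 * X.defQuad σ₁ v / X.tauSize v) (hr2 : 2 * X.defQuad σ₁ v / X.tauSize v < η₀)
    (hdisc : X.tauSize v ^ 2 - 12 * X.tauSize v * X.defQuad σ₁ v + 4 * X.defQuad σ₁ v ^ 2 < 0)
    {ε : X.E} (hε : IsIntegral ℤ ε) (h0 : ε ≠ 0) :
    0 ≤ (‖X.τ₀ ε‖ ^ 2 - 1) * X.tauSize v + 2 * (‖σ₁ ε‖ ^ 2 - 1) * X.defQuad σ₁ v ∧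
    (X.c ε * ε ≠ 1 → 0 < (‖X.τ₀ ε‖ ^ 2 - 1) * X.tauSize v + 2 * (‖σ₁ ε‖ ^ 2 - 1) * X.defQuad σ₁ v) := by
  have hσ₁ : σ₁ ∈ X.defEmb := by rw [hdef]; exact Finset.mem_insert_self _ _
  have hh : 0 < X.tauSize v := X.tauSize_pos hv
  have hq : 0 < X.defQuad σ₁ v := X.defQuad_pos hσ₁ hv
  have ht : 0 < ‖X.τ₀ ε‖ := norm_pos_iff.2 ((map_ne_zero _).2 h0)
  have hs : 0 < ‖X.τ₀ ε‖ ^ 2 := by positivity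
  have hN : ((|Algebra.norm ℚ ε| : ℚ) : ℝ) = ‖X.τ₀ ε‖ ^ 2 * ‖σ₁ ε‖ ^ 2 := X.abs_norm_eq_quartic hσ hdef ε
  by_cases hn : X.c ε * ε = 1
  · have hall := (forall_norm_eq_one_iff (fun σ y => X.conj_emb_c σ y) ε).2 hn
    rw [hall X.τ₀, hall σ₁]
    exact ⟨le_of_eq (by ring), fun h => absurd hn h⟩
  · have hpos : 0 < (‖X.τ₀ ε‖ ^ 2 - 1) * X.tauSize v + 2 * (‖σ₁ ε‖ ^ 2 - 1) * X.defQuad σ₁ v := by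
      rcases X.abs_norm_eq_one_or_two_le hε h0 with h1 | h2
      · have hgap := hU ε hε h0 h1 hn
        have hu : ‖σ₁ ε‖ ^ 2 = 1 / ‖X.τ₀ ε‖ ^ 2 := by
          have h1' : ((|Algebra.norm ℚ ε| : ℚ) : ℝ) = 1 := by rw [h1]; norm_num
          rw [h1'] at hN
          field_simp
          linarith
        rw [hu]
        exact slot_pos_of_unit hs hh hη hgap hr1 hr2
      · have h2' : (2 : ℝ) ≤ ((|Algebra.norm ℚ ε| : ℚ) : ℝ) := by exact_mod_cast h2
        have hu : ‖σ₁ ε‖ ^ 2 = ((|Algebra.norm ℚ ε| : ℚ) : ℝ) / ‖X.τ₀ ε‖ ^ 2 := by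
          rw [hN]
          field_simp
        rw [hu]
        exact slot_pos_of_two_le_norm hs h2' hh hq hdisc
    exact ⟨hpos.le, fun _ => hpos⟩

/-- **THE STRICT SIGNED PROFILE CONDITION IN THE QUARTIC CASE**: on a quartic CM field (`QuarticShape`), under the unit gap
`η₀ > 1` (`UnitGap`), for a centre with non-zero slots whose slot ratios `2 q_j / h_j` lie in `(1/η₀, η₀)` and whose sizes
satisfy the discriminant condition `h_j² − 12 h_j q_j + 4 q_j² < 0`, every non-norm-one tuple of non-zero algebraic
integers has `profileExc ε xm > 0` — the hypothesis `hprof` of CopyCountRayRed `eventually_copyCount_rayCentre_red`. -/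
theorem profileExc_pos_quartic (hQ : X.QuarticShape) {η₀ : ℝ} (hη : 1 < η₀) (hU : X.UnitGap η₀) (xm : X.Tuple)
    (hx : ∀ j, xm j ≠ 0)
    (hr1 : ∀ j, ∀ σ ∈ X.defEmb, 1 / η₀ < 2 * X.defQuad σ (xm j) / X.tauSize (xm j))
    (hr2 : ∀ j, ∀ σ ∈ X.defEmb, 2 * X.defQuad σ (xm j) / X.tauSize (xm j) < η₀)
    (hdisc : ∀ j, ∀ σ ∈ X.defEmb,
      X.tauSize (xm j) ^ 2 - 12 * X.tauSize (xm j) * X.defQuad σ (xm j) + 4 * X.defQuad σ (xm j) ^ 2 < 0)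
    {S : Set (Fin 4 → X.E)} (hS : X.IntegralScalars S) :
    ∀ ε ∈ X.NonNormOne S, 0 < X.profileExc ε xm := by
  obtain ⟨σ₁, hσ, hdef⟩ := hQ
  have hσ₁ : σ₁ ∈ X.defEmb := by rw [hdef]; exact Finset.mem_insert_self _ _
  rintro ε ⟨hεS, hε0, j₀, hj₀⟩
  rw [X.profileExc_eq]
  have hslot : ∀ j, (‖X.τ₀ (ε j)‖ ^ 2 - 1) * X.tauSize (xm j) +
      ∑ σ ∈ Finset.univ.filter (fun σ : X.E →+* ℂ => σ ≠ X.τ₀ ∧ σ ≠ conjEmb X.τ₀),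
        (‖σ (ε j)‖ ^ 2 - 1) * X.defQuad σ (xm j) =
      (‖X.τ₀ (ε j)‖ ^ 2 - 1) * X.tauSize (xm j) + 2 * (‖σ₁ (ε j)‖ ^ 2 - 1) * X.defQuad σ₁ (xm j) := fun j =>
    X.slot_exc_eq hσ hdef (ε j) (xm j)
  have hper : ∀ j, 0 ≤ (‖X.τ₀ (ε j)‖ ^ 2 - 1) * X.tauSize (xm j) + 2 * (‖σ₁ (ε j)‖ ^ 2 - 1) * X.defQuad σ₁ (xm j) ∧
      (X.c (ε j) * ε j ≠ 1 →
        0 < (‖X.τ₀ (ε j)‖ ^ 2 - 1) * X.tauSize (xm j) + 2 * (‖σ₁ (ε j)‖ ^ 2 - 1) * X.defQuad σ₁ (xm j)) := fun j =>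
    X.slot_exc_nonneg_pos hσ hdef hη hU (hx j) (hr1 j σ₁ hσ₁) (hr2 j σ₁ hσ₁) (hdisc j σ₁ hσ₁) (hS ε hεS j) (hε0 j)
  refine Finset.sum_pos' (fun j _ => ?_) ⟨j₀, Finset.mem_univ _, ?_⟩
  · rw [hslot j]
    exact (hper j).1
  · rw [hslot j₀]
    exact (hper j₀).2 hj₀

end T4Data

end Summit.Ventures.HodgeRepro.Tier4.Line3

end
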